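import Summits.BirchSwinnertonDyer.BirchSwinnertonDyer.Theses.SemiOrdinaryEisensteinDescent
import Summits.BirchSwinnertonDyer.BirchSwinnertonDyer.Theorems.SemiOrdinaryEisensteinDescentEisensteinKernelAtThreeRestrictedOfFrameOdd
import HarnessLib

/-!
# Route `SemiOrdinaryEisensteinDescent`, support item `EisensteinKernelAtThreeRestrictedOdd`
# (stmt-BirchSwinnertonDyer-24609): THE RESTRICTED KERNEL WITH CRUX #4 AT ODD `d_K` — published inputs →
# restricted Eisenstein inclusion `E′` → Kolyvagin upper bound → printed-inputs package (Hsieh ∧ BDP13 ∧ LZZ) →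
# `R₀`-frame at odd `d_K` from print → control → rank-zero twist → non-tower residual ⟹ the leaf, PROVED

Cell `bsd-wall` (W-ALL, row 2·3@3 lane 3), width seat `bsd-wall-soed-p1-w3` (gen 6), 2026-08-28, on the route
pen's text (planner bsd-wall-pss3x g2, SOED edit of 2026-08-28T01:58:36Z: crux #4 `WildSplitWaldspurgerAtThree`
(20385) ↦ aside, replaced in `closes` by the package `WildSplitPrintedInputsAtThree` (24476) + the frame-from-print
item `WildSplitFrameAtThreeOddOfPrint` (24475) and this re-packed kernel, which replaces 24156). Closes the support
item `EisensteinKernelAtThreeRestrictedOdd` of route `route-BirchSwinnertonDyer-SemiOrdinaryEisensteinDescent`: the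
theorem below has LITERALLY the type
`Summit.BirchSwinnertonDyer.BirchSwinnertonDyer.Theses.SemiOrdinaryEisensteinDescent.EisensteinKernelAtThreeRestrictedOdd`.

The proof is the item text's closer: destructure the package `hW = ⟨Hsieh, BDP13, LZZ⟩`, feed the frame item `hS`
with the two facts it asks for, and apply this seat's re-keyed kernel
`EisensteinKernelAtThreeRestrictedOfFrameOdd.wAllExclAddWildRankOneSurj_of_restricted_of_frameOdd` (p594734):
Jetchev–Skinner–Wan's §7.4 assembly at the wild split `3` (bed-p3 g1 / p588074 §3 verbatim) with the Waldspurger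
step replaced by ONE `R₀`-frame at the kernel's Friedberg–Hoffstein field (odd `d_K`) whose unit value is forced by
the Liu–Zhang–Zhang input (pointwise OfFrame argument).

HONEST FRAMING: this closes a SUPPORT item (pure assembly); every crux of the route
(`WildSplitEisensteinInclusionAtThreeRestricted`, `WildKolyvaginUpperAtThree`, `WildSplitControlAtThree`,
`WildRankZeroTwistAtThree`, `WildRankOneSurjNonTowerAtThree`), the frame item `WildSplitFrameAtThreeOddOfPrint`
(open: the cn100 port) and the printed inputs are ANTECEDENTS of the statement proved; `E′` has no engine in print
(walls W1–W3 of the leads' census). BSD is not proved for any curve by this file. No definition, no named fact,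
no `sorry`.

References: [JetchevSkinnerWan2017] §7.4.1 (arXiv:1512.06894 p. 30); [LiuZhangZhang2018] Thm 1.5.1, Thm 1.5.3;
[Castella2018] Thm. 2.3, §5; [GrossZagier1986] Thm. I.(6.3); [FriedbergHoffstein1995] Thm. B.
-/

noncomputable section

set_option linter.dupNamespace false
set_option autoImplicit false

namespace Summit.BirchSwinnertonDyer.BirchSwinnertonDyer.Theorems

open Summit.BirchSwinnertonDyer.BirchSwinnertonDyer.Theses.SemiOrdinaryEisensteinDescent

/-- **Item `EisensteinKernelAtThreeRestrictedOdd` (stmt-BirchSwinnertonDyer-24609) of route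
`SemiOrdinaryEisensteinDescent` holds**: `PublishedInputsWildThree → WildSplitEisensteinInclusionAtThreeRestricted →
WildKolyvaginUpperAtThree → WildSplitPrintedInputsAtThree → WildSplitFrameAtThreeOddOfPrint →
WildSplitControlAtThree → WildRankZeroTwistAtThree → WildRankOneSurjNonTowerAtThree ⟹
WAllExclAddWildRankOneSurj` — the restricted route kernel with crux #4 read at odd `d_K` only: the package
`⟨Hsieh, BDP13, LZZ⟩` feeds the frame-from-print item, and `wAllExclAddWildRankOneSurj_of_restricted_of_frameOdd`
(p594734) assembles the leaf (value at the frame forced by LZZ). Every crux is an antecedent; BSD is not proved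
by this. [cite: JetchevSkinnerWan2017, §7.4.1 (arXiv:1512.06894 p. 30)]
[cite: LiuZhangZhang2018, Thm 1.5.1 and Thm 1.5.3 (Duke Math. J. 167 pp. 748–749)] -/
theorem semiOrdinaryEisensteinDescent_eisensteinKernelAtThreeRestrictedOdd_proof :
    EisensteinKernelAtThreeRestrictedOdd := by
  unfold EisensteinKernelAtThreeRestrictedOdd
  intro hF hE' hKo hW hS hC hZ hNT
  obtain ⟨hH, hB, hL⟩ := hW
  exact EisensteinKernelAtThreeRestrictedOfFrameOdd.wAllExclAddWildRankOneSurj_of_restricted_of_frameOdd hF hE'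
    hKo hL (hS hH hB) hC hZ hNT

end Summit.BirchSwinnertonDyer.BirchSwinnertonDyer.Theorems

end
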